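/-
Copyright (c) 2026 the pub-hodgecm-mathlib formalisation cell (harness21).  Prover seat hodgecm-mathlib-LH4-p12 (g9), req620 Track A «(D-RAM) FOUR-FRAME» squad
((β₂) road (R-36), β₂ WORD #28 (b) ∕ #30 «K6-(c) OFF→GEN JUNCTION», SHELL HALF, part 1 of 2: the SIZE of the ray scalar on the odd-`d` row — inside, terminal), 2026-09-05.
-/
import Summits.HodgeConjecture.HodgeConjecture.Theorems.F0P3cDyRamUpperLineRayLetters   -- (this seat) `v_rayScalar_mul_eq`, `latticeInLevel_iff_v_rayScalar_le`, `exactLevel_iff_v_rayScalar_eq`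
import Summits.HodgeConjecture.HodgeConjecture.Theorems.F0P3cDyRamRowCellOnShell         -- ★ p863084 (LH4-p06 (g9)): `uniformizer_letters` (d even = the model); brings ★ p862572 `mul_map_sub_mul_map_eq`
import HarnessLib

/-!
# Crux `H413`, line LH4 «(D-RAM) FOUR-FRAME» — the (β₂) road (R-36), K6-(c) «OFF→GEN JUNCTION», SHELL HALF (1∕2): «THE RAY SCALAR OF AN ODD-ROW VERTEX» —
# on the odd-`d` live row `|lam − jE u₀₀| = |ϖE|^{2b+1}` (`ℓ₀ = 1`) a glued vertex INSIDE the cell range (`|μ − ρμ| ≤ |cc(α − ρα)|·|ϖE|^{b+2}`) is on BOTH shells `(1, M)`, a vertex of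
# the TERMINAL cell (`|μ − ρμ| = |cc(α − ρα)|·|ϖE|^b`) is on NEITHER, and in between the shell token IS the digit condition `|e₀| = |ϖ|`

Cell `hodgecm-mathlib` (D-0151), FLOOR 0, crux item H413 = `stmt-HodgeConjecture-24833`, route of record `HCCMUnconditional`; squad F0∕P3c∕LH4; lane
`--supports stmt-HodgeConjecture-24833 --as helper` (count-neutral; pays NO tier-0 row).  THEOREMS ONLY (no `def`, no instance, no notation, no `sorry`, default heartbeats);
★-only imports; states NO law; (β₂) stays a HYPOTHESIS.  DATUM-FREE: ★ (C1)'s line model `(M, jE, ρ, Θ, α)` (`ρ`, `Θ` commuting isometric involutions, `Fix ρ = jE(E)`, `ρα ≠ α`,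
`|α| ≤ 1`, `|ϖ| = exp(−1)`, `|jE c| ≤ 1 ↔ |c| ≤ 1`), a cell scalar `cc = ρcc` with the CELL letters of ★ p863084 (`Y ∈ 𝒪_cc` Gram-primitive, `|Y| = |ϖE|^b`, `1 ≤ b`, `|cc| ≤ |ϖE|^b`),
and SIZE tokens only — NO residue field, NO `|2|`, ANY `q`.  `|jE ϖ|` is never evaluated (types
RamK and RamM read the same statements: the odd-`d` live row is `|μ| = |ϖE|^{2b+1}` in both, LH4-p16 (g2) 00:32:42Z «`m = 4b + 2(d%2)`»).

WHY (β₂ WORD #28 (b) ∕ #30 «K6-(c)»; LH4-p16 (g2) 00:40:23Z «the ROW-cell shell lemma at ODD d — does a ★ exist?»; split 01:20:47Z with LH7-p10 (g3), who types the existence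
half).  At even `d` (`ℓ₀ = 0`) ★ p863084 puts every row vertex strictly inside the anti-diagonal on level EXACTLY `0`.  At ODD `d` the shells ask level `1` on the row
`|μ| = |ϖE|^{2b+1}`; by ★ `…UpperLineRayLetters` the level token is the size of the ray scalar (`|e₀|·|cc(α − ρα)| = |κ − ρκ|`, `κ = μ∕Y`), and `κ − ρκ = (B·P − A·Q)(α − ρα)∕(Y·ρY)`
in ★ p862572's `Fix ρ`-coordinates (`|Q| ∈ (|cc|·|ϖE|, |cc|]` by Gram-primitivity).  Three regimes, decided by `|B| = |μ − ρμ|∕|α − ρα|`: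
* INSIDE `|μ − ρμ| ≤ |cc(α − ρα)|·|ϖE|^{b+2}` (lane B: `j + b + 2 ≤ jl`): `|A| = |ϖE|^{2b+1}`, `A·Q` dominates STRICTLY, `|ϖ|² < |e₀| ≤ |ϖ|`, so `|e₀| = |ϖ|`: ON both shells.
* TERMINAL `|μ − ρμ| = |cc(α − ρα)|·|ϖE|^b`, `|cc| < |ϖE|^b` (lane B: `j + b = jl`): `B·P` dominates, `|e₀| = 1`: level EXACTLY `0`, on NEITHER shell.
* BOUNDARY (lane B: `j + b + 1 = jl`): the two tie, `|e₀| ≤ |ϖ|` varies — the shell token IS the digit condition `|e₀| = |ϖ|` (LH4-p19 (g3)'s `NX`).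
THIS FILE (1∕2): §1 the skew sizes `v_skew_le_of_row_inside`, `lt_v_skew_of_row_inside`, `v_skew_eq_of_row_terminal` (any `Y ∈ 𝒪_cc`); §1b on `Y := dualGen … x₀`:
`v_rayScalar_eq_of_row_inside` (`|e₀| = |ϖ|`), `v_rayScalar_eq_one_of_row_terminal` (`|e₀| = 1`).  Part 2 (`…RowCellShellOddD`) turns these into the shells of a glued vertex.
HONEST LABEL.  Count-neutral valuation ∕ order algebra; nothing printed is asserted; no census law is stated; ‹ROW›∕‹ROW-ODD›∕‹CORE-*›∕‹FLIPT› and every (OFF) band letter stay OPEN;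
`HC_CM` is proved only modulo the 7 printed citations (2 remaining named inputs: hLiu418 = `stmt-HodgeConjecture-24832`, h413 = `stmt-HodgeConjecture-24833`) until rung 0 closes.
## References
* [Serre1979] J.-P. Serre, *Local Fields*, GTM 67 (1979): Ch. III §3 Prop. 7, Ch. III §6 Prop. 12 (orders of conductor `c`).
* [Jacobowitz1962] R. Jacobowitz, *Hermitian forms over local fields*, Amer. J. Math. 84 (1962): §4 (duals, Gram-primitivity, gluing).
* [Kottwitz1986BaseChangeUnits] R. E. Kottwitz, *Base change for unit elements of Hecke algebras*, Compositio Math. 60 (1986): §1 pp. 240–241, §3 (congruence levels).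
* [Rogawski1990] J. D. Rogawski, *Automorphic Representations of Unitary Groups in Three Variables*, Ann. of Math. Stud. 123 (1990): §4.9 Prop. 4.9.1 (b) p. 55.
-/

set_option autoImplicit false

noncomputable section

namespace Summit.HodgeConjecture.HodgeConjecture.Cruxes.H413.F0P3cDyRamRowCellRayScalarOddD

open scoped Valued WithZero Matrix MatrixGroups
open WithZero
open Literature.NumberTheory.Automorphic Literature.NumberTheory.Automorphic.HermitianLattice Literature.NumberTheory.Automorphic.UnitaryLatticeTree
open Literature.NumberTheory.Rogawski1990
open Summit.HodgeConjecture.HodgeConjecture.Cruxes.H413.F0P3cDyRamToricCensusDefs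
open Summit.HodgeConjecture.HodgeConjecture.Cruxes.H413.F0P3cDyRamRowCellOnShell (uniformizer_letters)
open Summit.HodgeConjecture.HodgeConjecture.Cruxes.H413.F0P3cDyRamTerminalCellOffShellCardTwo (mul_map_sub_mul_map_eq)
open Summit.HodgeConjecture.HodgeConjecture.Cruxes.H413.F0P3cDyRamUpperLineRayLetters (v_rayScalar_mul_eq)
open Summit.HodgeConjecture.HodgeConjecture.Cruxes.H413.F0P3cDyRamDiagonalCellCleanRegime (v_map_le_pow_iff)
open Summit.HodgeConjecture.HodgeConjecture.Cruxes.H413.F0P3cDyRamBoundaryCellLetterCardTwo (v_map_eq_map_pow_iff)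

variable {E M : Type} [Field E] [Valued E ℤᵐ⁰] [Field M] [Valued M ℤᵐ⁰] {ρ Θ : M →+* M} {α : M}

/-! ## §1 The skew of the depth quotient on the odd-`d` row: inside, terminal -/

omit [Valued M ℤᵐ⁰] in
/-- **THE SKEW OF `κ = μ∕Y` IN COORDINATES**: `κ − ρκ = (B·P − A·Q)·(α − ρα)∕(Y·ρY)` (★ p862572; `Y`, `ρY ≠ 0`). [cite: Serre1979, Ch. III §6 Prop. 12] -/
theorem div_sub_map_div_eq_of_coords (hα : ρ α ≠ α) {μ Y A B P Q : M} (hY0 : Y ≠ 0) (hρY0 : ρ Y ≠ 0)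
    (hB : B = (μ - ρ μ) / (α - ρ α)) (hA : A = μ - B * α) (hQ : Q = (Y - ρ Y) / (α - ρ α)) (hP : P = Y - Q * α) :
    μ / Y - ρ (μ / Y) = (B * P - A * Q) * (α - ρ α) / (Y * ρ Y) := by
  rw [map_div₀, div_sub_div _ _ hY0 hρY0, mul_map_sub_mul_map_eq hα hB hA hQ hP]

/-- **INSIDE THE ODD ROW THE SKEW IS AT MOST `|cc(α − ρα)|·|ϖE|`** (level `≥ 1`): `ρ` isometric, `ρα ≠ α`, `|α| ≤ 1`, `|ϖ| = exp(−1)`, `|jE c| ≤ 1 ↔ |c| ≤ 1`; CELL `Y ∈ 𝒪_cc`,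
`|Y| = |ϖE|^b`, `|cc| ≤ |ϖE|^b`; ROW `|μ| ≤ |ϖE|^{2b+1}`, INSIDE `|μ − ρμ| ≤ |cc(α − ρα)|·|ϖE|^{b+2}`.  THEN `|μ∕Y − ρ(μ∕Y)| ≤ |cc(α − ρα)|·|ϖE|`.
[cite: Serre1979, Ch. III §6 Prop. 12] [cite: Kottwitz1986BaseChangeUnits, §1 pp. 240–241] -/
theorem v_skew_le_of_row_inside
    (hvρ : ∀ x, Valued.v (ρ x) = Valued.v x) (hα : ρ α ≠ α) (hα1 : Valued.v α ≤ 1)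
    (jE : E →+* M) (hjv : ∀ c, Valued.v (jE c) ≤ 1 ↔ Valued.v c ≤ 1) {ϖ : E} (hϖ : Valued.v ϖ = exp (-1 : ℤ))
    {cc Y : M} (hYO : IsOrd ρ α cc Y) {b : ℕ} (hYb : Valued.v Y = Valued.v (jE ϖ) ^ b) (hcb : Valued.v cc ≤ Valued.v (jE ϖ) ^ b)
    {μ : M} (hμ : Valued.v μ ≤ Valued.v (jE ϖ) ^ (2 * b + 1)) (hanti : Valued.v (μ - ρ μ) ≤ Valued.v (cc * (α - ρ α)) * Valued.v (jE ϖ) ^ (b + 2)) :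
    Valued.v (μ / Y - ρ (μ / Y)) ≤ Valued.v (cc * (α - ρ α)) * Valued.v (jE ϖ) := by
  have hvαpos : 0 < Valued.v (α - ρ α) := zero_lt_iff.2 ((Valuation.ne_zero_iff _).2 (sub_ne_zero.2 (Ne.symm hα)))
  obtain ⟨-, -, -, hvjϖ0, hvjϖpos, hjϖlt, hjϖle⟩ := uniformizer_letters jE hjv hϖ
  have hY0 : Y ≠ 0 := fun h0 => pow_ne_zero b hvjϖ0 (hYb.symm.trans (by rw [h0, Valuation.map_zero]))
  have hρY0 : ρ Y ≠ 0 := (map_ne_zero ρ).2 hY0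
  set B : M := (μ - ρ μ) / (α - ρ α) with hBdef
  set Q : M := (Y - ρ Y) / (α - ρ α) with hQdef
  set A : M := μ - B * α with hAdef
  set P : M := Y - Q * α with hPdef
  clear_value A P B Q
  have hvB : Valued.v B ≤ Valued.v cc * Valued.v (jE ϖ) ^ (b + 2) := by
    rw [hBdef, Valuation.map_div, div_le_iff₀ hvαpos]
    calc Valued.v (μ - ρ μ) ≤ Valued.v (cc * (α - ρ α)) * Valued.v (jE ϖ) ^ (b + 2) := hanti
      _ = Valued.v cc * Valued.v (jE ϖ) ^ (b + 2) * Valued.v (α - ρ α) := by rw [Valuation.map_mul]; ac_rfl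
  have hvQ : Valued.v Q ≤ Valued.v cc := by rw [hQdef, Valuation.map_div, div_le_iff₀ hvαpos, ← Valuation.map_mul]; exact hYO.2
  have hvP : Valued.v P ≤ Valued.v (jE ϖ) ^ b := by
    rw [hPdef]; refine (Valuation.map_sub _ _ _).trans (max_le hYb.le ?_); rw [Valuation.map_mul]
    exact (mul_le_mul' hvQ hα1).trans (by rw [mul_one]; exact hcb)
  have hvA : Valued.v A ≤ Valued.v (jE ϖ) ^ (2 * b + 1) := by
    rw [hAdef]; refine (Valuation.map_sub _ _ _).trans (max_le hμ ?_); rw [Valuation.map_mul]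
    calc Valued.v B * Valued.v α ≤ Valued.v cc * Valued.v (jE ϖ) ^ (b + 2) * 1 := mul_le_mul' hvB hα1
      _ ≤ Valued.v (jE ϖ) ^ b * Valued.v (jE ϖ) ^ (b + 2) := by rw [mul_one]; exact mul_le_mul' hcb le_rfl
      _ = Valued.v (jE ϖ) ^ (2 * b + 2) := by rw [← pow_add]; congr 1; omega
      _ ≤ Valued.v (jE ϖ) ^ (2 * b + 1) := pow_le_pow_right_of_le_one' hjϖle (by omega)
  have hBP : Valued.v (B * P) ≤ Valued.v cc * Valued.v (jE ϖ) ^ (2 * b + 1) := by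
    rw [Valuation.map_mul]
    calc Valued.v B * Valued.v P ≤ Valued.v cc * Valued.v (jE ϖ) ^ (b + 2) * Valued.v (jE ϖ) ^ b := mul_le_mul' hvB hvP
      _ = Valued.v cc * Valued.v (jE ϖ) ^ (2 * b + 2) := by rw [mul_assoc, ← pow_add]; congr 2; omega
      _ ≤ Valued.v cc * Valued.v (jE ϖ) ^ (2 * b + 1) := mul_le_mul' le_rfl (pow_le_pow_right_of_le_one' hjϖle (by omega))
  have hAQ : Valued.v (A * Q) ≤ Valued.v cc * Valued.v (jE ϖ) ^ (2 * b + 1) := by rw [Valuation.map_mul, mul_comm]; exact mul_le_mul' hvQ hvA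
  have hdiff : Valued.v (B * P - A * Q) ≤ Valued.v cc * Valued.v (jE ϖ) ^ (2 * b + 1) := (Valuation.map_sub _ _ _).trans (max_le hBP hAQ)
  rw [div_sub_map_div_eq_of_coords hα hY0 hρY0 hBdef hAdef hQdef hPdef, Valuation.map_div, Valuation.map_mul, Valuation.map_mul, hvρ, hYb,
    div_le_iff₀ (mul_pos (pow_pos hvjϖpos _) (pow_pos hvjϖpos _))]
  calc Valued.v (B * P - A * Q) * Valued.v (α - ρ α) ≤ Valued.v cc * Valued.v (jE ϖ) ^ (2 * b + 1) * Valued.v (α - ρ α) := mul_le_mul' hdiff le_rfl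
    _ = Valued.v (cc * (α - ρ α)) * Valued.v (jE ϖ) * (Valued.v (jE ϖ) ^ b * Valued.v (jE ϖ) ^ b) := by
        rw [Valuation.map_mul, pow_succ, two_mul, pow_add]; ac_rfl

/-- **INSIDE THE ODD ROW THE SKEW EXCEEDS `|cc(α − ρα)|·|ϖE|²`** (NOT level `≥ 2`): same frame with `ρ(ϖE) = ϖE`, CELL Gram-primitive (`Y∕ϖE ∉ 𝒪_cc`), `1 ≤ b`; ROW
`|μ| = |ϖE|^{2b+1}` EXACTLY, INSIDE `|μ − ρμ| ≤ |cc(α − ρα)|·|ϖE|^{b+2}`.  THEN `|cc(α − ρα)|·|ϖE|² < |μ∕Y − ρ(μ∕Y)|`: `|A| = |ϖE|^{2b+1}`, `|Q| > |cc|·|ϖE|`, and `A·Q`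
dominates `B·P` strictly (the odd-row twin of ★ p863084 `not_isOrd_div_mul_of_row`). [cite: Serre1979, Ch. III §6 Prop. 12] [cite: Jacobowitz1962, §4] [cite: Kottwitz1986BaseChangeUnits, §3] -/
theorem lt_v_skew_of_row_inside
    (hvρ : ∀ x, Valued.v (ρ x) = Valued.v x) (hα : ρ α ≠ α) (hα1 : Valued.v α ≤ 1)
    (jE : E →+* M) (hjv : ∀ c, Valued.v (jE c) ≤ 1 ↔ Valued.v c ≤ 1) {ϖ : E} (hϖ : Valued.v ϖ = exp (-1 : ℤ)) (hρϖ : ρ (jE ϖ) = jE ϖ)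
    {cc Y : M} (hYO : IsOrd ρ α cc Y) (hYprim : ¬ IsOrd ρ α cc (Y / jE ϖ)) {b : ℕ} (hb1 : 1 ≤ b) (hYb : Valued.v Y = Valued.v (jE ϖ) ^ b)
    (hcb : Valued.v cc ≤ Valued.v (jE ϖ) ^ b)
    {μ : M} (hμ : Valued.v μ = Valued.v (jE ϖ) ^ (2 * b + 1)) (hanti : Valued.v (μ - ρ μ) ≤ Valued.v (cc * (α - ρ α)) * Valued.v (jE ϖ) ^ (b + 2)) :
    Valued.v (cc * (α - ρ α)) * Valued.v (jE ϖ) ^ 2 < Valued.v (μ / Y - ρ (μ / Y)) := by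
  have hvαpos : 0 < Valued.v (α - ρ α) := zero_lt_iff.2 ((Valuation.ne_zero_iff _).2 (sub_ne_zero.2 (Ne.symm hα)))
  obtain ⟨-, -, -, hvjϖ0, hvjϖpos, hjϖlt, hjϖle⟩ := uniformizer_letters jE hjv hϖ
  have hY0 : Y ≠ 0 := fun h0 => pow_ne_zero b hvjϖ0 (hYb.symm.trans (by rw [h0, Valuation.map_zero]))
  have hρY0 : ρ Y ≠ 0 := (map_ne_zero ρ).2 hY0
  -- Gram-primitivity as a STRICT lower bound on `|Y − ρY|`
  have hYρ : Valued.v (cc * (α - ρ α)) * Valued.v (jE ϖ) < Valued.v (Y - ρ Y) := by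
    by_contra hle
    push Not at hle
    apply hYprim
    refine ⟨?_, ?_⟩
    · rw [Valuation.map_div, hYb, div_le_one₀ hvjϖpos]
      calc Valued.v (jE ϖ) ^ b ≤ Valued.v (jE ϖ) ^ 1 := pow_le_pow_right_of_le_one' hjϖle hb1
        _ = Valued.v (jE ϖ) := pow_one _
    · have e : Y / jE ϖ - ρ (Y / jE ϖ) = (Y - ρ Y) / jE ϖ := by
        rw [map_div₀, hρϖ]
        field_simp
      rw [e, Valuation.map_div, div_le_iff₀ hvjϖpos]
      exact hle
  set B : M := (μ - ρ μ) / (α - ρ α) with hBdef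
  set Q : M := (Y - ρ Y) / (α - ρ α) with hQdef
  set A : M := μ - B * α with hAdef
  set P : M := Y - Q * α with hPdef
  clear_value A P B Q
  have hvB : Valued.v B ≤ Valued.v cc * Valued.v (jE ϖ) ^ (b + 2) := by
    rw [hBdef, Valuation.map_div, div_le_iff₀ hvαpos]
    calc Valued.v (μ - ρ μ) ≤ Valued.v (cc * (α - ρ α)) * Valued.v (jE ϖ) ^ (b + 2) := hanti
      _ = Valued.v cc * Valued.v (jE ϖ) ^ (b + 2) * Valued.v (α - ρ α) := by rw [Valuation.map_mul]; ac_rfl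
  have hvQlo : Valued.v cc * Valued.v (jE ϖ) < Valued.v Q := by
    rw [hQdef, Valuation.map_div, lt_div_iff₀ hvαpos]
    calc Valued.v cc * Valued.v (jE ϖ) * Valued.v (α - ρ α) = Valued.v (cc * (α - ρ α)) * Valued.v (jE ϖ) := by rw [Valuation.map_mul]; ac_rfl
      _ < Valued.v (Y - ρ Y) := hYρ
  have hvQ : Valued.v Q ≤ Valued.v cc := by rw [hQdef, Valuation.map_div, div_le_iff₀ hvαpos, ← Valuation.map_mul]; exact hYO.2
  have hvP : Valued.v P ≤ Valued.v (jE ϖ) ^ b := by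
    rw [hPdef]; refine (Valuation.map_sub _ _ _).trans (max_le hYb.le ?_); rw [Valuation.map_mul]
    exact (mul_le_mul' hvQ hα1).trans (by rw [mul_one]; exact hcb)
  -- `|A| = |ϖE|^{2b+1}` exactly: `|Bα| ≤ |cc|·|ϖE|^{b+2} ≤ |ϖE|^{2b+2} < |μ|`
  have hvBα : Valued.v (B * α) < Valued.v μ := by
    rw [Valuation.map_mul, hμ]
    calc Valued.v B * Valued.v α ≤ Valued.v cc * Valued.v (jE ϖ) ^ (b + 2) * 1 := mul_le_mul' hvB hα1
      _ ≤ Valued.v (jE ϖ) ^ b * Valued.v (jE ϖ) ^ (b + 2) := by rw [mul_one]; exact mul_le_mul' hcb le_rfl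
      _ = Valued.v (jE ϖ) ^ (2 * b + 2) := by rw [← pow_add]; congr 1; omega
      _ < Valued.v (jE ϖ) ^ (2 * b + 1) := pow_lt_pow_right_of_lt_one₀ hvjϖpos hjϖlt (by omega)
  have hvA : Valued.v A = Valued.v (jE ϖ) ^ (2 * b + 1) := by rw [hAdef, Valuation.map_sub_eq_of_lt_left _ hvBα, hμ]
  -- `AQ` dominates `BP` strictly
  have hAQlo : Valued.v cc * Valued.v (jE ϖ) ^ (2 * b + 2) < Valued.v (A * Q) := by
    rw [Valuation.map_mul, hvA]
    calc Valued.v cc * Valued.v (jE ϖ) ^ (2 * b + 2) = Valued.v (jE ϖ) ^ (2 * b + 1) * (Valued.v cc * Valued.v (jE ϖ)) := by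
          rw [pow_succ]; ac_rfl
      _ < Valued.v (jE ϖ) ^ (2 * b + 1) * Valued.v Q := mul_lt_mul_of_pos_left hvQlo (pow_pos hvjϖpos _)
  have hBP : Valued.v (B * P) ≤ Valued.v cc * Valued.v (jE ϖ) ^ (2 * b + 2) := by
    rw [Valuation.map_mul]
    calc Valued.v B * Valued.v P ≤ Valued.v cc * Valued.v (jE ϖ) ^ (b + 2) * Valued.v (jE ϖ) ^ b := mul_le_mul' hvB hvP
      _ = Valued.v cc * Valued.v (jE ϖ) ^ (2 * b + 2) := by rw [mul_assoc, ← pow_add]; congr 2; omega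
  have hdiff : Valued.v cc * Valued.v (jE ϖ) ^ (2 * b + 2) < Valued.v (B * P - A * Q) := by
    rw [Valuation.map_sub_eq_of_lt_right _ (lt_of_le_of_lt hBP hAQlo)]; exact hAQlo
  have hnum : Valued.v ((B * P - A * Q) * (α - ρ α)) = Valued.v (B * P - A * Q) * Valued.v (α - ρ α) := Valuation.map_mul _ _ _
  have hdenv : Valued.v (Y * ρ Y) = Valued.v (jE ϖ) ^ b * Valued.v (jE ϖ) ^ b := by rw [Valuation.map_mul, hvρ, hYb]
  rw [div_sub_map_div_eq_of_coords hα hY0 hρY0 hBdef hAdef hQdef hPdef, Valuation.map_div, hnum, hdenv,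
    lt_div_iff₀ (mul_pos (pow_pos hvjϖpos _) (pow_pos hvjϖpos _))]
  calc Valued.v (cc * (α - ρ α)) * Valued.v (jE ϖ) ^ 2 * (Valued.v (jE ϖ) ^ b * Valued.v (jE ϖ) ^ b)
      = Valued.v cc * Valued.v (jE ϖ) ^ (2 * b + 2) * Valued.v (α - ρ α) := by
        rw [Valuation.map_mul, pow_add, two_mul, pow_add]; simp only [pow_two, mul_assoc, mul_comm, mul_left_comm]
    _ < Valued.v (B * P - A * Q) * Valued.v (α - ρ α) := mul_lt_mul_of_pos_right hdiff hvαpos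

/-- **ON THE TERMINAL CELL OF THE ODD ROW THE SKEW IS EXACTLY `|cc(α − ρα)|`** (level EXACTLY `0`): frame as above; CELL `Y ∈ 𝒪_cc`, `|Y| = |ϖE|^b`, `|cc| < |ϖE|^b`; ROW
`|μ| ≤ |ϖE|^{2b+1}`; TERMINAL `|μ − ρμ| = |cc(α − ρα)|·|ϖE|^b` EXACTLY.  THEN `|μ∕Y − ρ(μ∕Y)| = |cc(α − ρα)|`: `|P| = |ϖE|^b` exactly and `B·P` dominates `A·Q`.
[cite: Serre1979, Ch. III §6 Prop. 12] [cite: Kottwitz1986BaseChangeUnits, §1 pp. 240–241] -/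
theorem v_skew_eq_of_row_terminal
    (hvρ : ∀ x, Valued.v (ρ x) = Valued.v x) (hα : ρ α ≠ α) (hα1 : Valued.v α ≤ 1)
    (jE : E →+* M) (hjv : ∀ c, Valued.v (jE c) ≤ 1 ↔ Valued.v c ≤ 1) {ϖ : E} (hϖ : Valued.v ϖ = exp (-1 : ℤ))
    {cc Y : M} (hc0 : cc ≠ 0) (hYO : IsOrd ρ α cc Y) {b : ℕ} (hYb : Valued.v Y = Valued.v (jE ϖ) ^ b) (hcb : Valued.v cc < Valued.v (jE ϖ) ^ b)
    {μ : M} (hμ : Valued.v μ ≤ Valued.v (jE ϖ) ^ (2 * b + 1)) (hanti : Valued.v (μ - ρ μ) = Valued.v (cc * (α - ρ α)) * Valued.v (jE ϖ) ^ b) :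
    Valued.v (μ / Y - ρ (μ / Y)) = Valued.v (cc * (α - ρ α)) := by
  have hvαpos : 0 < Valued.v (α - ρ α) := zero_lt_iff.2 ((Valuation.ne_zero_iff _).2 (sub_ne_zero.2 (Ne.symm hα)))
  have hvα0 : Valued.v (α - ρ α) ≠ 0 := ne_of_gt hvαpos
  obtain ⟨-, -, -, hvjϖ0, hvjϖpos, hjϖlt, hjϖle⟩ := uniformizer_letters jE hjv hϖ
  have hY0 : Y ≠ 0 := fun h0 => pow_ne_zero b hvjϖ0 (hYb.symm.trans (by rw [h0, Valuation.map_zero]))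
  have hρY0 : ρ Y ≠ 0 := (map_ne_zero ρ).2 hY0
  set B : M := (μ - ρ μ) / (α - ρ α) with hBdef
  set Q : M := (Y - ρ Y) / (α - ρ α) with hQdef
  set A : M := μ - B * α with hAdef
  set P : M := Y - Q * α with hPdef
  clear_value A P B Q
  have hccpos : 0 < Valued.v cc := zero_lt_iff.2 ((Valuation.ne_zero_iff _).2 hc0)
  have hvB : Valued.v B = Valued.v cc * Valued.v (jE ϖ) ^ b := by
    rw [hBdef, Valuation.map_div, hanti, Valuation.map_mul, mul_right_comm, mul_div_assoc, div_self hvα0, mul_one]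
  have hvQ : Valued.v Q ≤ Valued.v cc := by rw [hQdef, Valuation.map_div, div_le_iff₀ hvαpos, ← Valuation.map_mul]; exact hYO.2
  -- `|P| = |ϖE|^b` exactly: `|Qα| ≤ |cc| < |ϖE|^b = |Y|`
  have hvQα : Valued.v (Q * α) < Valued.v Y := by
    rw [Valuation.map_mul, hYb]
    calc Valued.v Q * Valued.v α ≤ Valued.v cc * 1 := mul_le_mul' hvQ hα1
      _ < Valued.v (jE ϖ) ^ b := by rw [mul_one]; exact hcb
  have hvP : Valued.v P = Valued.v (jE ϖ) ^ b := by rw [hPdef, Valuation.map_sub_eq_of_lt_left _ hvQα, hYb]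
  -- `|A| < |ϖE|^{2b}`: `|μ| ≤ |ϖE|^{2b+1} < |ϖE|^{2b}` and `|Bα| ≤ |cc|·|ϖE|^b < |ϖE|^{2b}`
  have hvA : Valued.v A < Valued.v (jE ϖ) ^ (2 * b) := by
    rw [hAdef]
    refine (Valuation.map_sub _ _ _).trans_lt (max_lt (hμ.trans_lt (pow_lt_pow_right_of_lt_one₀ hvjϖpos hjϖlt (by omega))) ?_)
    rw [Valuation.map_mul, hvB]
    calc Valued.v cc * Valued.v (jE ϖ) ^ b * Valued.v α ≤ Valued.v cc * Valued.v (jE ϖ) ^ b * 1 := mul_le_mul' le_rfl hα1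
      _ < Valued.v (jE ϖ) ^ b * Valued.v (jE ϖ) ^ b * 1 := by
          rw [mul_one, mul_one]; exact mul_lt_mul_of_pos_right hcb (pow_pos hvjϖpos _)
      _ = Valued.v (jE ϖ) ^ (2 * b) := by rw [mul_one, ← pow_add, two_mul]
  -- `BP` dominates `AQ` strictly
  have hBPv : Valued.v (B * P) = Valued.v cc * Valued.v (jE ϖ) ^ (2 * b) := by
    rw [Valuation.map_mul, hvB, hvP, mul_assoc, ← pow_add, two_mul]
  have hAQlt : Valued.v (A * Q) < Valued.v (B * P) := by
    rw [hBPv, Valuation.map_mul]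
    calc Valued.v A * Valued.v Q ≤ Valued.v A * Valued.v cc := mul_le_mul' le_rfl hvQ
      _ < Valued.v (jE ϖ) ^ (2 * b) * Valued.v cc := mul_lt_mul_of_pos_right hvA hccpos
      _ = Valued.v cc * Valued.v (jE ϖ) ^ (2 * b) := mul_comm _ _
  have hdiff : Valued.v (B * P - A * Q) = Valued.v cc * Valued.v (jE ϖ) ^ (2 * b) := by
    rw [Valuation.map_sub_eq_of_lt_left _ hAQlt, hBPv]
  have hden : Valued.v (jE ϖ) ^ b * Valued.v (jE ϖ) ^ b ≠ 0 := ne_of_gt (mul_pos (pow_pos hvjϖpos _) (pow_pos hvjϖpos _))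
  rw [div_sub_map_div_eq_of_coords hα hY0 hρY0 hBdef hAdef hQdef hPdef, Valuation.map_div, Valuation.map_mul, Valuation.map_mul, hvρ, hYb, hdiff,
    div_eq_iff hden, Valuation.map_mul, two_mul, pow_add]
  ac_rfl

/-! ### §1b The ray scalar `e₀ ∈ E` (`jE e₀ = Tr_ρ(μ∕(cc(α − ρα)·ΘY))`, `Y = dualGen ρ Θ α cc h x₀`) on the odd row -/

/-- **INSIDE THE ODD ROW `|e₀| = |ϖ|`** (the level digit is EXACTLY `ℓ₀ = 1`).  Line model (`ρ`, `Θ` commuting isometric involutions, `Θh = h`, `ρcc = cc`, `cc(α − ρα) ≠ 0`,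
`ρ(ϖE) = ϖE`, `|ϖ| = exp(−1)`, `|jE c| ≤ 1 ↔ |c| ≤ 1`), CELL letters of ★ p863084 on `Y = dualGen … x₀`, ROW `|μ| = |ϖE|^{2b+1}`, INSIDE `|μ − ρμ| ≤ |cc(α − ρα)|·|ϖE|^{b+2}`.
[cite: Serre1979, Ch. III §3 Prop. 7, §6 Prop. 12] [cite: Jacobowitz1962, §4] -/
theorem v_rayScalar_eq_of_row_inside
    (hρρ : ∀ x, ρ (ρ x) = x) (hvρ : ∀ x, Valued.v (ρ x) = Valued.v x) (hΘΘ : ∀ x, Θ (Θ x) = x) (hΘρ : ∀ x, Θ (ρ x) = ρ (Θ x))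
    (hvΘ : ∀ x, Valued.v (Θ x) = Valued.v x) (hα : ρ α ≠ α) (hα1 : Valued.v α ≤ 1)
    (jE : E →+* M) (hjv : ∀ c, Valued.v (jE c) ≤ 1 ↔ Valued.v c ≤ 1) {ϖ : E} (hϖ : Valued.v ϖ = exp (-1 : ℤ)) (hρϖ : ρ (jE ϖ) = jE ϖ)
    {hM : M} (hΘh : Θ hM = hM) {cc : M} (hc : ρ cc = cc) (hcc : cc * (α - ρ α) ≠ 0) {x₀ : M}
    (hYO : IsOrd ρ α cc (dualGen ρ Θ α cc hM x₀)) (hYprim : ¬ IsOrd ρ α cc (dualGen ρ Θ α cc hM x₀ / jE ϖ)) {b : ℕ} (hb1 : 1 ≤ b)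
    (hYb : Valued.v (dualGen ρ Θ α cc hM x₀) = Valued.v (jE ϖ) ^ b) (hcb : Valued.v cc ≤ Valued.v (jE ϖ) ^ b)
    {μ : M} (hμ : Valued.v μ = Valued.v (jE ϖ) ^ (2 * b + 1)) (hanti : Valued.v (μ - ρ μ) ≤ Valued.v (cc * (α - ρ α)) * Valued.v (jE ϖ) ^ (b + 2))
    {e₀ : E} (he₀ : jE e₀ = μ / (cc * (α - ρ α) * Θ (dualGen ρ Θ α cc hM x₀)) + ρ (μ / (cc * (α - ρ α) * Θ (dualGen ρ Θ α cc hM x₀)))) :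
    Valued.v e₀ = Valued.v ϖ := by
  obtain ⟨hϖ0, -, -, -, -, -, -⟩ := uniformizer_letters jE hjv hϖ
  have hvcc : 0 < Valued.v (cc * (α - ρ α)) := zero_lt_iff.2 ((Valuation.ne_zero_iff _).2 hcc)
  have hmul := v_rayScalar_mul_eq hρρ hΘΘ hΘρ hvΘ hΘh hc hcc x₀ μ he₀
  -- `|jE e₀| ≤ |ϖE|` and `¬ |jE e₀| ≤ |ϖE|²`
  have hle : Valued.v (jE e₀) ≤ Valued.v (jE ϖ) ^ 1 := by
    rw [pow_one]
    have h := v_skew_le_of_row_inside hvρ hα hα1 jE hjv hϖ hYO hYb hcb hμ.le hanti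
    rw [← hmul, mul_comm (Valued.v (cc * (α - ρ α)))] at h
    exact le_of_mul_le_mul_right h hvcc
  have hnot : ¬ Valued.v (jE e₀) ≤ Valued.v (jE ϖ) ^ 2 := fun h2 => by
    have h := lt_v_skew_of_row_inside hvρ hα hα1 jE hjv hϖ hρϖ hYO hYprim hb1 hYb hcb hμ hanti
    rw [← hmul] at h
    exact absurd (lt_of_lt_of_le h (by rw [mul_comm]; exact mul_le_mul' le_rfl h2)) (lt_irrefl _)
  rw [v_map_le_pow_iff jE hjv hϖ0] at hle hnot
  -- `ℤᵐ⁰` discreteness in `E`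
  rw [pow_one] at hle
  have hx0 : Valued.v e₀ ≠ 0 := fun h0 => hnot (by rw [h0]; exact zero_le)
  rw [hϖ] at hle ⊢
  rw [hϖ, ← exp_nsmul] at hnot
  rw [← exp_log hx0, exp_le_exp] at hle hnot
  rw [← exp_log hx0]; congr 1; simp only [nsmul_eq_mul] at hnot; omega

/-- **ON THE TERMINAL CELL OF THE ODD ROW `|e₀| = 1`** (the level digit is `0`: the vertex is below the `ℓ₀ = 1` shell).  Same frame; CELL `cc ≠ 0`, `|cc| < |ϖE|^b`; ROW
`|μ| ≤ |ϖE|^{2b+1}`; TERMINAL `|μ − ρμ| = |cc(α − ρα)|·|ϖE|^b`. [cite: Serre1979, Ch. III §3 Prop. 7, §6 Prop. 12] [cite: Jacobowitz1962, §4] -/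
theorem v_rayScalar_eq_one_of_row_terminal
    (hρρ : ∀ x, ρ (ρ x) = x) (hvρ : ∀ x, Valued.v (ρ x) = Valued.v x) (hΘΘ : ∀ x, Θ (Θ x) = x) (hΘρ : ∀ x, Θ (ρ x) = ρ (Θ x))
    (hvΘ : ∀ x, Valued.v (Θ x) = Valued.v x) (hα : ρ α ≠ α) (hα1 : Valued.v α ≤ 1)
    (jE : E →+* M) (hjv : ∀ c, Valued.v (jE c) ≤ 1 ↔ Valued.v c ≤ 1) {ϖ : E} (hϖ : Valued.v ϖ = exp (-1 : ℤ))
    {hM : M} (hΘh : Θ hM = hM) {cc : M} (hc : ρ cc = cc) (hc0 : cc ≠ 0) (hcc : cc * (α - ρ α) ≠ 0) {x₀ : M}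
    (hYO : IsOrd ρ α cc (dualGen ρ Θ α cc hM x₀)) {b : ℕ} (hYb : Valued.v (dualGen ρ Θ α cc hM x₀) = Valued.v (jE ϖ) ^ b) (hcb : Valued.v cc < Valued.v (jE ϖ) ^ b)
    {μ : M} (hμ : Valued.v μ ≤ Valued.v (jE ϖ) ^ (2 * b + 1)) (hanti : Valued.v (μ - ρ μ) = Valued.v (cc * (α - ρ α)) * Valued.v (jE ϖ) ^ b)
    {e₀ : E} (he₀ : jE e₀ = μ / (cc * (α - ρ α) * Θ (dualGen ρ Θ α cc hM x₀)) + ρ (μ / (cc * (α - ρ α) * Θ (dualGen ρ Θ α cc hM x₀)))) :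
    Valued.v e₀ = 1 := by
  obtain ⟨hϖ0, -, -, -, -, -, -⟩ := uniformizer_letters jE hjv hϖ
  have hne : Valued.v (cc * (α - ρ α)) ≠ 0 := (Valuation.ne_zero_iff _).2 hcc
  have hmul := v_rayScalar_mul_eq hρρ hΘΘ hΘρ hvΘ hΘh hc hcc x₀ μ he₀
  rw [v_skew_eq_of_row_terminal hvρ hα hα1 jE hjv hϖ hc0 hYO hYb hcb hμ hanti, mul_eq_right₀ hne] at hmul
  have h := (v_map_eq_map_pow_iff jE hjv hϖ0 e₀ 0).1 (by rw [pow_zero]; exact hmul)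
  rwa [pow_zero] at h

end Summit.HodgeConjecture.HodgeConjecture.Cruxes.H413.F0P3cDyRamRowCellRayScalarOddD

end
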